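import Summits.Ventures.PercRepro.C011Induction

/-!
# PercRepro — Lemma 4: the cross-term form of the C-011 edge induction (typer-2, gen 3)

`proofs/LEAD-C011-concavity.md` §10.3 (lead g3, 04:27Z): along any edge `g`, with
`π⁰ = law(p[g := 0])`, `π¹ = law(p[g := 1])` and the symmetric bilinear form `Q⁺` of the slack
(`Φ⁺(π) = Q⁺(π, π)`),

  `Φ⁺(p[g := t]) = (1 − t)²·Φ⁺(p[g := 0]) + 2t(1 − t)·Q⁺(π⁰, π¹) + t²·Φ⁺(p[g := 1])`,

so `M_g := Q⁺(π⁰, π¹) ≥ 0` along the edges used by the induction gives C-011 — a WEAKER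
hypothesis than concavity (`2M_g ≥ Φ⁺(0) + Φ⁺(1)`).  Named `CrossTermPlusNonneg` here (p3's
`CrossTermNonneg` is the C-005 cross term of `C005CrossTerm.lean`).

* `quadPlus u v` — `Q⁺`; `phiPlus_eq_quadPlus` (`Φ⁺ = Q⁺(π, π)`), `quadPlus_comm`;
* `law4_update_eq` — the law is affine in one weight; `phiPlus_update_bernstein` — the identity;
* `MultiGraph.crossTermPlus p g` — `M_g`; **`CrossTermPlusNonneg`** (every edge),
  **`C011_of_CrossTermPlusNonneg`** (induction on free edges);
* **`CrossTermPlusNonnegSure`** (free edges with an endpoint sure-connected to one of four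
  distinct marks — the choose-the-edge version) and **`C011_of_CrossTermPlusNonnegSure`**;
* `MultiGraph.crossTermPlus_ge_of_concave`: concavity along an edge gives `M_g ≥ ½(Φ⁺(0) + Φ⁺(1))`;
* `deltaQuad` — the `t²`-coefficient `Q⁺(Δ_g, Δ_g)`; `concaveOn_phiPlus_iff` (concavity along `g` ⟺
  `Q⁺(Δ_g, Δ_g) ≤ 0`); **`EdgeQuadNonpos`** (the lemma in `t²`-coefficient form, §1),
  `PhiPlus_edge_concave_iff_EdgeQuadNonpos`, `C011_of_EdgeQuadNonpos`.
-/

namespace PercRepro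

open Finset

/-! ### The bilinear form of `Φ⁺` -/

/-- `r_j` of a law vector: the rank-1 mass below the crossing cell `x_j`
(`r₁ = π 4 + π 13`, `r₂ = π 7 + π 12`, `r₃ = π 11 + π 10`). -/
def rank1Of (π : Fin 15 → ℝ) : Fin 3 → ℝ := ![π 4 + π 13, π 7 + π 12, π 11 + π 10]

/-- `x_i` of a law vector: the crossing masses (`π 3, π 6, π 8`). -/
def crossOf (π : Fin 15 → ℝ) : Fin 3 → ℝ := ![π 3, π 6, π 8]

/-- **The symmetric bilinear form `Q⁺`** of the slack of C-005⁺: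
`Q⁺(u, v) = ½(u_⊤ v_⊥ + u_⊥ v_⊤) − ½ Σ_{i≠j} u_{x_i} v_{x_j} − ½ Σ_{i≠j} (u_{x_i} v_{r_j} + u_{r_j} v_{x_i})`. -/
noncomputable def quadPlus (u v : Fin 15 → ℝ) : ℝ :=
  (u 0 * v 14 + u 14 * v 0) / 2 -
    (∑ i : Fin 3, ∑ j : Fin 3, if i ≠ j then crossOf u i * crossOf v j else 0) / 2 -
    (∑ i : Fin 3, ∑ j : Fin 3, if i ≠ j then
      crossOf u i * rank1Of v j + rank1Of u j * crossOf v i else 0) / 2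

/-- `Q⁺` is symmetric. -/
theorem quadPlus_comm (u v : Fin 15 → ℝ) : quadPlus u v = quadPlus v u := by
  simp only [quadPlus, crossOf, rank1Of, Fin.sum_univ_three]
  simp
  ring

/-- `Q⁺` is bilinear along a segment: the Bernstein expansion of `Q⁺((1−t)u + tv, (1−t)u + tv)`. -/
theorem quadPlus_segment (u v : Fin 15 → ℝ) (t : ℝ) :
    quadPlus (fun s => (1 - t) * u s + t * v s) (fun s => (1 - t) * u s + t * v s) =
      (1 - t) ^ 2 * quadPlus u u + 2 * t * (1 - t) * quadPlus u v + t ^ 2 * quadPlus v v := by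
  simp only [quadPlus, crossOf, rank1Of, Fin.sum_univ_three]
  simp
  ring

namespace MultiGraph

variable {V E : Type*} (G : MultiGraph V E) [Fintype E] [DecidableEq E]

/-- `Φ⁺` is the quadratic form of `Q⁺` at the law. -/
theorem phiPlus_eq_quadPlus (p : E → ℝ) (a b c d : V) :
    G.PhiPlus p a b c d = quadPlus (G.law4 p a b c d) (G.law4 p a b c d) := by
  simp only [PhiPlus, liabilitySum_eq, quadPlus, crossOf, rank1Of, Fin.sum_univ_three]
  simp
  ring

/-- The law of the marked partition is affine in one weight. -/
theorem law4_update_eq (p : E → ℝ) (g : E) (t : ℝ) (a b c d : V) :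
    G.law4 (Function.update p g t) a b c d =
      fun s => (1 - t) * G.law4 (Function.update p g 0) a b c d s +
        t * G.law4 (Function.update p g 1) a b c d s := by
  funext s
  simp only [law4]
  rw [prob_update]
  ring

/-- **The cross term `M_g = Q⁺(π⁰_g, π¹_g)`** of an edge. -/
noncomputable def crossTermPlus (p : E → ℝ) (g : E) (a b c d : V) : ℝ :=
  quadPlus (G.law4 (Function.update p g 0) a b c d) (G.law4 (Function.update p g 1) a b c d)

/-- **The Bernstein expansion of `Φ⁺` along an edge**:
`Φ⁺(p[g := t]) = (1 − t)² Φ⁺(p[g := 0]) + 2t(1 − t) M_g + t² Φ⁺(p[g := 1])`. -/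
theorem phiPlus_update_bernstein (p : E → ℝ) (g : E) (t : ℝ) (a b c d : V) :
    G.PhiPlus (Function.update p g t) a b c d =
      (1 - t) ^ 2 * G.PhiPlus (Function.update p g 0) a b c d +
        2 * t * (1 - t) * G.crossTermPlus p g a b c d +
        t ^ 2 * G.PhiPlus (Function.update p g 1) a b c d := by
  rw [phiPlus_eq_quadPlus, law4_update_eq, quadPlus_segment, ← phiPlus_eq_quadPlus,
    ← phiPlus_eq_quadPlus, crossTermPlus]

end MultiGraph

/-- **Lemma 4** (`LEAD-C011-concavity.md` §10.3): the cross term of every edge is nonnegative,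
`0 ≤ Q⁺(law(p[g := 0]), law(p[g := 1]))`. -/
def CrossTermPlusNonneg : Prop :=
  ∀ {V E : Type} [Fintype E] [DecidableEq E] (G : MultiGraph V E) (p : E → ℝ), IsProb p →
    ∀ (a b c d : V) (g : E), 0 ≤ G.crossTermPlus p g a b c d

/-- **Lemma 4 in free-edge form**: the cross term is nonnegative along every FREE edge with an
endpoint sure-connected to one of four distinct marks. -/
def CrossTermPlusNonnegSure : Prop :=
  ∀ {V E : Type} [Fintype E] [DecidableEq E] (G : MultiGraph V E) (p : E → ℝ), IsProb p →
    ∀ (a b c d : V), [a, b, c, d].Nodup → ∀ g : E, IsFree p g →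
      (∃ m, (m = a ∨ m = b ∨ m = c ∨ m = d) ∧
        (G.SureConn p (G.fst g) m ∨ G.SureConn p (G.snd g) m)) →
      0 ≤ G.crossTermPlus p g a b c d

/-- Lemma 4 for every edge gives the free-edge form. -/
theorem CrossTermPlusNonnegSure_of_CrossTermPlusNonneg (h : CrossTermPlusNonneg) :
    CrossTermPlusNonnegSure :=
  fun G p hp a b c d _ g _ _ => h G p hp a b c d g

/-- The one-edge step of the Bernstein induction: `Φ⁺(p[g := 0]) ≥ 0`, `Φ⁺(p[g := 1]) ≥ 0` and
`M_g ≥ 0` give `Φ⁺(p) ≥ 0`. -/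
theorem MultiGraph.phiPlus_nonneg_of_crossTerm {V E : Type*} (G : MultiGraph V E) [Fintype E]
    [DecidableEq E] {p : E → ℝ} (hp : IsProb p) (g : E) (a b c d : V)
    (h0 : 0 ≤ G.PhiPlus (Function.update p g 0) a b c d)
    (h1 : 0 ≤ G.PhiPlus (Function.update p g 1) a b c d)
    (hM : 0 ≤ G.crossTermPlus p g a b c d) : 0 ≤ G.PhiPlus p a b c d := by
  have key := G.phiPlus_update_bernstein p g (p g) a b c d
  rw [Function.update_eq_self g p] at key
  rw [key]
  have hg0 : (0 : ℝ) ≤ p g := hp.nonneg g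
  have hg1 : p g ≤ 1 := hp.le_one g
  have h1t : (0 : ℝ) ≤ 1 - p g := sub_nonneg.mpr hg1
  have := mul_nonneg (mul_nonneg (mul_nonneg (by norm_num : (0:ℝ) ≤ 2) hg0) h1t) hM
  have := mul_nonneg (pow_nonneg h1t 2) h0
  have := mul_nonneg (pow_nonneg hg0 2) h1
  linarith

/-- **C-005⁺ from Lemma 4** (induction on the free edges, Bernstein form of the step). -/
theorem C011_of_CrossTermPlusNonneg (h : CrossTermPlusNonneg) : C011 := by
  rw [C011_iff_phiPlus_nonneg]
  intro V E _ _ G p hp a b c d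
  refine induction_free (P := fun q => 0 ≤ G.PhiPlus q a b c d) ?_ ?_ hp
  · intro σ
    rw [G.phiPlus_detWeights]
  · intro q g hq h1 h0
    exact G.phiPlus_nonneg_of_crossTerm hq g a b c d h0 h1 (h G q hq a b c d g)

/-- **C-005⁺ from Lemma 4 in free-edge form** (the choose-the-edge induction of
`C011_of_Concavity5Sure` with the cross-term step). -/
theorem C011_of_CrossTermPlusNonnegSure (h4 : CrossTermPlusNonnegSure) : C011 := by
  rw [C011_iff_phiPlus_nonneg]
  intro V E _ _ G p hp a b c d
  by_cases hn : [a, b, c, d].Nodup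
  swap
  · rw [G.phiPlus_eq_zero_of_not_nodup p hn]
  suffices key : ∀ n : ℕ, ∀ q : E → ℝ, IsProb q → (freeEdges q).card = n →
      0 ≤ G.PhiPlus q a b c d from key _ p hp rfl
  intro n
  induction n using Nat.strong_induction_on with
  | _ n ih =>
    intro q hq hcard
    by_cases hex : ∃ g, IsFree q g ∧ ∃ m, (m = a ∨ m = b ∨ m = c ∨ m = d) ∧
        (G.SureConn q (G.fst g) m ∨ G.SureConn q (G.snd g) m)
    · obtain ⟨g, hg, hm⟩ := hex
      have h0 : 0 ≤ G.PhiPlus (Function.update q g 0) a b c d :=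
        ih _ (by rw [← hcard]; exact card_freeEdges_update_lt hg (Or.inl rfl)) _
          (hq.update g ⟨le_rfl, zero_le_one⟩) rfl
      have h1 : 0 ≤ G.PhiPlus (Function.update q g 1) a b c d :=
        ih _ (by rw [← hcard]; exact card_freeEdges_update_lt hg (Or.inr rfl)) _
          (hq.update g ⟨zero_le_one, le_rfl⟩) rfl
      exact G.phiPlus_nonneg_of_crossTerm hq g a b c d h0 h1 (h4 G q hq a b c d hn g hg hm)
    · push Not at hex
      rw [G.phiPlus_eq_zero_of_noFreeIncident hq hex]

/-- Concavity along an edge implies the cross-term inequality there: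
`2 M_g ≥ Φ⁺(0) + Φ⁺(1) ≥ 0` once the endpoints are nonnegative — here in the form the lead
states it: concavity on `[0, 1]` gives `M_g ≥ ½(Φ⁺(0) + Φ⁺(1))`. -/
theorem MultiGraph.crossTermPlus_ge_of_concave {V E : Type*} (G : MultiGraph V E) [Fintype E]
    [DecidableEq E] (p : E → ℝ) (g : E) (a b c d : V)
    (hc : ConcaveOn ℝ (Set.Icc (0 : ℝ) 1) fun t => G.PhiPlus (Function.update p g t) a b c d) :
    (G.PhiPlus (Function.update p g 0) a b c d + G.PhiPlus (Function.update p g 1) a b c d) / 2 ≤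
      G.crossTermPlus p g a b c d := by
  have key := hc.2 (Set.left_mem_Icc.mpr zero_le_one) (Set.right_mem_Icc.mpr zero_le_one)
    (by norm_num : (0 : ℝ) ≤ 1 / 2) (by norm_num : (0 : ℝ) ≤ 1 / 2) (by norm_num)
  simp only [smul_eq_mul, mul_zero, zero_add, mul_one] at key
  rw [G.phiPlus_update_bernstein p g (1 / 2) a b c d] at key
  linarith

/-! ### The `t²`-coefficient form: concavity along `g` ⟺ `Q⁺(Δ_g, Δ_g) ≤ 0` -/

/-- `Q⁺(v − u, v − u) = Q⁺(v, v) − 2 Q⁺(u, v) + Q⁺(u, u)`. -/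
theorem quadPlus_sub_sub (u v : Fin 15 → ℝ) :
    quadPlus (fun s => v s - u s) (fun s => v s - u s) =
      quadPlus v v - 2 * quadPlus u v + quadPlus u u := by
  simp only [quadPlus, crossOf, rank1Of, Fin.sum_univ_three]
  simp
  ring

namespace MultiGraph

variable {V E : Type*} (G : MultiGraph V E) [Fintype E] [DecidableEq E]

/-- **The `t²`-coefficient `Q⁺(Δ_g, Δ_g)`** of `t ↦ Φ⁺(p[g := t])`, `Δ_g = π¹_g − π⁰_g`
(`LEAD-C011-concavity.md` §1: the concavity lemma is `Q⁺(Δ_g, Δ_g) ≤ 0`). -/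
noncomputable def deltaQuad (p : E → ℝ) (g : E) (a b c d : V) : ℝ :=
  quadPlus (fun s => G.law4 (Function.update p g 1) a b c d s - G.law4 (Function.update p g 0) a b c d s)
    (fun s => G.law4 (Function.update p g 1) a b c d s - G.law4 (Function.update p g 0) a b c d s)

/-- `Q⁺(Δ_g, Δ_g) = Φ⁺(1) − 2 M_g + Φ⁺(0)`. -/
theorem deltaQuad_eq (p : E → ℝ) (g : E) (a b c d : V) :
    G.deltaQuad p g a b c d =
      G.PhiPlus (Function.update p g 1) a b c d - 2 * G.crossTermPlus p g a b c d +
        G.PhiPlus (Function.update p g 0) a b c d := by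
  rw [deltaQuad, quadPlus_sub_sub, phiPlus_eq_quadPlus, phiPlus_eq_quadPlus, crossTermPlus]

/-- `t ↦ Φ⁺(p[g := t])` as a quadratic polynomial with leading coefficient `Q⁺(Δ_g, Δ_g)`. -/
theorem phiPlus_update_eq_poly (p : E → ℝ) (g : E) (t : ℝ) (a b c d : V) :
    G.PhiPlus (Function.update p g t) a b c d =
      G.PhiPlus (Function.update p g 0) a b c d +
        2 * t * (G.crossTermPlus p g a b c d - G.PhiPlus (Function.update p g 0) a b c d) +
        t ^ 2 * G.deltaQuad p g a b c d := by
  rw [phiPlus_update_bernstein, deltaQuad_eq]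
  ring

/-- **Concavity along `g` is exactly `Q⁺(Δ_g, Δ_g) ≤ 0`** (a quadratic is concave on `[0, 1]` iff
its leading coefficient is `≤ 0`). -/
theorem concaveOn_phiPlus_iff (p : E → ℝ) (g : E) (a b c d : V) :
    ConcaveOn ℝ (Set.Icc (0 : ℝ) 1) (fun t => G.PhiPlus (Function.update p g t) a b c d) ↔
      G.deltaQuad p g a b c d ≤ 0 := by
  constructor
  · intro hc
    have key := hc.2 (Set.left_mem_Icc.mpr zero_le_one) (Set.right_mem_Icc.mpr zero_le_one)
      (by norm_num : (0 : ℝ) ≤ 1 / 2) (by norm_num : (0 : ℝ) ≤ 1 / 2) (by norm_num)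
    simp only [smul_eq_mul, mul_zero, zero_add, mul_one] at key
    rw [G.phiPlus_update_eq_poly p g (1 / 2) a b c d, G.phiPlus_update_eq_poly p g 1 a b c d,
      G.phiPlus_update_eq_poly p g 0 a b c d] at key
    nlinarith [key]
  · intro hq
    refine ⟨convex_Icc 0 1, fun x _ y _ α β hα hβ hαβ => ?_⟩
    simp only [smul_eq_mul]
    rw [G.phiPlus_update_eq_poly p g x a b c d, G.phiPlus_update_eq_poly p g y a b c d,
      G.phiPlus_update_eq_poly p g (α * x + β * y) a b c d]
    have hβ' : β = 1 - α := by linarith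
    subst hβ'
    nlinarith [mul_nonneg (mul_nonneg hα hβ) (mul_nonneg (sq_nonneg (x - y)) (neg_nonneg.mpr hq))]

end MultiGraph

/-- **The concavity lemma in `t²`-coefficient form**: `Q⁺(Δ_g, Δ_g) ≤ 0` for every edge. -/
def EdgeQuadNonpos : Prop :=
  ∀ {V E : Type} [Fintype E] [DecidableEq E] (G : MultiGraph V E) (p : E → ℝ), IsProb p →
    ∀ (a b c d : V) (g : E), G.deltaQuad p g a b c d ≤ 0

/-- The two forms of the concavity lemma agree. -/
theorem PhiPlus_edge_concave_iff_EdgeQuadNonpos : PhiPlus_edge_concave ↔ EdgeQuadNonpos := by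
  constructor
  · intro h V E _ _ G p hp a b c d g
    exact (G.concaveOn_phiPlus_iff p g a b c d).mp (h G p hp a b c d g)
  · intro h V E _ _ G p hp a b c d g
    exact (G.concaveOn_phiPlus_iff p g a b c d).mpr (h G p hp a b c d g)

/-- **C-005⁺ from the `t²`-coefficient form** of the concavity lemma. -/
theorem C011_of_EdgeQuadNonpos (h : EdgeQuadNonpos) : C011 :=
  C011_of_PhiPlus_edge_concave (PhiPlus_edge_concave_iff_EdgeQuadNonpos.mpr h)

end PercRepro
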